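import Summits.HodgeConjecture.HodgeConjecture.Theses.NoetherLefschetzOneUp
import Literature.AlgebraicGeometry.Motives.SurfaceNetGeometricGenus
import Literature.AlgebraicGeometry.HodgeTheory.BirationalMorphismDegree
import Literature.AlgebraicGeometry.Motives.FiberNetExistence
import Literature.AlgebraicGeometry.Motives.FiberNetExistenceDischarge
import Literature.AlgebraicGeometry.Motives.FiberNetExistenceProofs

/-!
# Route NoetherLefschetzOneUp — `NetReduction` (item stmt-HodgeConjecture-11604): every fourfold enters through a net

The support item `NetReduction` of route `HodgeConjecture/NoetherLefschetzOneUp`: for every smooth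
projective complex fourfold `X` there are a smooth projective fourfold `X'` and a surjective
`f : X' ⟶ ℙ²` whose fibres over the `ℂ`-points off a proper Zariski-closed `T ⊊ ℙ²` are smooth
projective surfaces admitting Hodge models with ONE constant `h^{2,0} = g`, such that algebraicity
of all rational `(2,2)`-classes of `X'` implies that of all rational `(2,2)`-classes of `X`.

The printed proof (item docstring: Hartshorne II 7.17.3 + Bertini; generic smoothness;
Ehresmann + semicontinuity; `σ_* σ^* = id`) is assembled here on the tree's carriers
(`Motives.FiberNet` / `SurfaceNet` of `Motives/SurfaceNet`, the geometric genus predicates of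
`Motives/SurfaceNetGeometricGenus`) from:

* two PRINTED THEOREMS the tree cannot yet prove, stated inline as closed named facts for the gate
  to relocate to `Literature/AlgebraicGeometry/Motives/FiberNetExistence` (no blow-ups of
  projective varieties / Bertini / relative Hodge theory in Mathlib or the tree):
  `exists_fiberNet_smoothBase_nonempty` (EXISTENCE of nets with non-empty smooth base:
  Hartshorne II Example 7.17.3, II Thm. 8.18, III Cor. 10.7; Fulton–Hansen) and
  `fiberNet_exists_hasFibreHodgeNumber` (CONSTANCY of the Hodge numbers of the smooth fibres:
  Voisin I Prop. 9.20, with the tree's theorem `nonempty_hodgeModel_holds` for the Hodge models);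
* two theorems of the tree: Hodge models exist (`nonempty_hodgeModel_holds`) and algebraicity of
  rational `(p,p)`-classes DESCENDS ALONG BIRATIONAL MORPHISMS
  (`mem_algebraicClasses_of_isBirational`, `HodgeTheory/BirationalMorphismDegree`: the blow-down
  has degree `1`, projection formula), applied to the blow-down of the net
  (`isBirational_blowDown`).

Result: `netReduction_of : Literature.AlgebraicGeometry.Motives.exists_fiberNet_smoothBase_nonempty → Literature.AlgebraicGeometry.Motives.fiberNet_exists_hasFibreHodgeNumber →
NetReduction` (CONDITIONAL on the two facts;
`X' := N.total`, `f := N.proj`, `T :=` the discriminant, `g :=` the common geometric genus).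
-/

-- `Summit.HodgeConjecture.HodgeConjecture.Theorems` is the mandated namespace (single-problem summit),
-- flagged by `linter.dupNamespace`; the lakefile turns the linter off tree-wide, restated here.
set_option linter.dupNamespace false

noncomputable section

open CategoryTheory AlgebraicGeometry
open Literature.AlgebraicGeometry Literature.AlgebraicGeometry.Motives
open Literature.AlgebraicGeometry.HodgeTheory

namespace Summit.HodgeConjecture.HodgeConjecture.Theorems

/-- **The blow-down of a net is birational**: for a net `N` of `r`-folds on a smooth projective
`(m + r)`-fold `X`, `σ : X̃ ⟶ X` restricts to an isomorphism over the complement of the base locus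
(structure field), a non-empty open subset of the irreducible `X` (dense) whose preimage is a
non-empty open subset of the irreducible `X̃` (dense) — Stacks 01RN, the tree's
`Resolution.IsBirational`. [folklore] -/
theorem isBirational_blowDown {r m : ℕ} {X : SchemeOver ℂ} (hX : IsSmoothProjective (m + r) X)
    (N : FiberNet r m X) : Resolution.IsBirational N.blowDown.left := by
  haveI := hX.geometricallyIrreducible
  haveI : IrreducibleSpace X.left := GeometricallyIrreducible.irreducibleSpace_of_subsingleton X.hom
  haveI := N.irreducibleSpace_total
  refine ⟨N.offBaseLocus, ?_, ?_, N.isIso_blowDown_restrict⟩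
  · exact N.isClosed_baseLocus.isOpen_compl.dense N.offBaseLocus_nonempty
  · refine (N.blowDown.left ⁻¹ᵁ N.offBaseLocus).2.dense ?_
    obtain ⟨x, hx⟩ := N.offBaseLocus_nonempty
    obtain ⟨y, hy⟩ := N.compl_baseLocus_subset_range_blowDown hx
    exact ⟨y, show N.blowDown.left.base y ∈ N.offBaseLocus from hy ▸ hx⟩

/-- **`NetReduction`, granted the two printed theorems** (item stmt-HodgeConjecture-11604 of route
`HodgeConjecture/NoetherLefschetzOneUp`; Hartshorne II 7.17.3 + Bertini, generic smoothness,
Voisin I Prop. 9.20, `σ_* σ^* = id`). For a smooth projective complex fourfold `X` take a surface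
net `N` over `ℙ²` with non-empty smooth base (`exists_fiberNet_smoothBase_nonempty`, `r = m = 2`),
`X' := N.total` (a smooth projective fourfold), `f := N.proj` (surjective: geometrically connected
fibres), `T :=` the discriminant (closed, `≠ ℙ²`), off which the rational fibres are smooth
projective surfaces (`FiberNet.isSmoothProjective_fiber_of_mem_smoothBase`) with Hodge models of
one common `h^{2,0} = g` (`fiberNet_exists_hasFibreHodgeNumber`; packaged by
`SurfaceNet.HasGeometricGenus.routeHypotheses`); and algebraicity of the rational `(2,2)`-classes
descends from `X'` to `X` along the birational blow-down (`isBirational_blowDown`,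
`mem_algebraicClasses_of_isBirational`: degree `1` and the projection formula). The conclusion is
literally the route decl `NetReduction`; the result is CONDITIONAL on the two named facts.
[cite: Hartshorne1977, II Example 7.17.3] [cite: VoisinHodgeI2002, §9.3.2 Prop. 9.20]
[cite: Fulton1998, Lemma 19.1.2] -/
theorem netReduction_of (hnet : Literature.AlgebraicGeometry.Motives.exists_fiberNet_smoothBase_nonempty)
    (hpg : Literature.AlgebraicGeometry.Motives.fiberNet_exists_hasFibreHodgeNumber) :
    Summit.HodgeConjecture.HodgeConjecture.Theses.NoetherLefschetzOneUp.NetReduction := by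
  unfold Summit.HodgeConjecture.HodgeConjecture.Theses.NoetherLefschetzOneUp.NetReduction
  intro X hX
  -- a surface net on `X` over `ℙ²` with non-empty smooth base, and its common geometric genus `g`
  obtain ⟨N, hU⟩ := hnet 2 2 (by norm_num) hX
  obtain ⟨g, hg⟩ := hpg 2 2 N 2 2 0
  obtain ⟨h4, hsurj, T, hT, hTne, hfib⟩ :=
    SurfaceNet.HasGeometricGenus.routeHypotheses (N := N) hg hU
  refine ⟨N.total, N.proj, h4, hsurj, ⟨T, hT, hTne, g, hfib⟩, ?_⟩
  -- algebraicity of rational `(2,2)`-classes descends along the birational blow-down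
  intro h' c hc hpp
  exact mem_algebraicClasses_of_isBirational h4 hX N.blowDown (isBirational_blowDown hX N) h' c hc hpp

/-! ## The minimal inputs: surface nets on fourfolds and GENERIC constancy of `p_g`

`netReduction_of` consumes the two named facts in their printed generality (nets of `r`-folds
over `ℙᵐ` for all `r ≥ 1` and all `m`; constancy of EVERY Hodge number `h^{p,q}` on the WHOLE
smooth base). The item needs much less, and the theorems below record the exact residue so that a
discharge may aim at it (seat c2, 2026-08-16; the item stays open on the net-existence fact):

* NETS — `Nonempty (SurfaceNet 2 X)` for smooth projective complex FOURFOLDS `X` only: the smooth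
  base of such a net is automatically non-empty (generic smoothness, Hartshorne III Cor. 10.7,
  PROVED as `FiberNet.smoothBase_nonempty_of_charZero` in `Motives/FiberNetExistence`);
* GENUS — for such a net, ONE value `g` of `h^{2,0}` of the fibres over the `ℂ`-points of SOME
  non-empty Zariski-open `V ⊆ U` inside the smooth base ("generic constancy"). This is what UPPER
  SEMICONTINUITY of `b ↦ p_g(S_b) = h⁰(S_b, Ω²_{S_b})` alone gives (Hartshorne III Thm. 12.8 for the
  locally free `Ω²_{π⁻¹U/U}` of the smooth projective family `π⁻¹U → U`: the minimum value of an
  upper semicontinuous `ℕ`-valued function on the irreducible `U` is attained exactly on a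
  non-empty open subset), with no appeal to Ehresmann's theorem / Voisin I Prop. 9.20 (constancy
  on all of `U(ℂ)`), and it is all that `NetReduction` asks: the closed set of the item is then
  `T := ℙ² ∖ V ⊇ Δ` rather than the discriminant itself.

On the other side nothing can be weakened: on a fourfold `X` for which the `(2,2)` statement
fails, the item demands a netted smooth projective fourfold `X'` on which it fails too, i.e. one
receiving the offending class of `X` — a net on (a variety dominating) `X` itself; so the
net-existence input is used exactly on that branch and cannot be replaced by a fixed model net
(e.g. the product nets of `Motives/FiberNetProduct`).
-/

/-- **`NetReduction` from surface nets on fourfolds with GENERICALLY constant geometric genus**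
(the minimal form of the two inputs of `netReduction_of`). Assume (i) every smooth projective
complex fourfold `X` carries a surface net `N` over `ℙ²` (`Motives.SurfaceNet 2 X`: smooth
projective total space `X̃`, blow-down `σ : X̃ → X` an isomorphism off a proper closed base locus,
net map `π : X̃ → ℙ²` with geometrically connected fibres — Hartshorne II Example 7.17.3 + II
Thm. 8.18, Fulton–Hansen), and (ii) for every such net there are a non-empty open `V ⊆ ℙ²` inside
the smooth base and ONE `g` with `h^{2,0}(S_b) = g` for a Hodge model of every fibre `S_b`,
`b ∈ V(ℂ)` (generic constancy of the geometric genus: upper semicontinuity, Hartshorne III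
Thm. 12.8, or Voisin I Prop. 9.20). Then `NetReduction` holds with `X' := X̃`, `f := π`,
`T := ℙ² ∖ V` (closed, `≠ ℙ²` as `V ≠ ∅`; off `T` the rational fibres lie over the smooth base,
hence are smooth projective surfaces, `FiberNet.isSmoothProjective_fiber_of_mem_smoothBase`), the
given `g`, and the descent of algebraicity of rational `(2,2)`-classes along the birational
blow-down (`isBirational_blowDown`, `mem_algebraicClasses_of_isBirational`: `σ_* σ^* = id`).
[cite: Hartshorne1977, II Example 7.17.3 and III Thm. 12.8] [cite: VoisinHodgeI2002, §9.3.2 Prop. 9.20]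
[cite: Fulton1998, Lemma 19.1.2] -/
theorem netReduction_of_generic_geometricGenus
    (hnet : ∀ ⦃X : SchemeOver ℂ⦄, IsSmoothProjective 4 X → Nonempty (SurfaceNet 2 X))
    (hpg : ∀ ⦃X : SchemeOver ℂ⦄, IsSmoothProjective 4 X → ∀ N : SurfaceNet 2 X,
      ∃ V : (projectiveSpace 2 ℂ).left.Opens, (V : Set (projectiveSpace 2 ℂ).left).Nonempty ∧
        V ≤ N.smoothBase ∧ ∃ g : ℕ, ∀ b : AlgPoints (projectiveSpace 2 ℂ) ℂ, b.pt ∈ V →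
          ∃ A : HodgeModel 2 (FiberNet.fiber N b), Module.finrank ℂ ↥(A.hodgePQ 2 2 0) = g) :
    Summit.HodgeConjecture.HodgeConjecture.Theses.NoetherLefschetzOneUp.NetReduction := by
  unfold Summit.HodgeConjecture.HodgeConjecture.Theses.NoetherLefschetzOneUp.NetReduction
  intro X hX
  -- a surface net on `X` over `ℙ²`, a non-empty open `V ⊆ U` and the generic geometric genus `g`
  obtain ⟨N⟩ := hnet hX
  obtain ⟨V, hVne, hVU, g, hg⟩ := hpg hX N
  refine ⟨N.total, N.proj, N.isSmoothProjective_four_total, FiberNet.surjective_proj N,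
    ⟨(V : Set (projectiveSpace 2 ℂ).left)ᶜ, V.isOpen.isClosed_compl, ?_, g, fun s hs => ?_⟩, ?_⟩
  · -- `T := ℙ² ∖ V ≠ ℙ²` since `V ≠ ∅`
    intro h
    obtain ⟨b, hb⟩ := hVne
    have hb' : b ∈ (V : Set (projectiveSpace 2 ℂ).left)ᶜ := h ▸ Set.mem_univ b
    exact hb' hb
  · -- off `T` the rational fibre lies over `V ⊆ U`: smooth projective surface, `h^{2,0} = g`
    have hsV : s.pt ∈ (V : Set (projectiveSpace 2 ℂ).left) := not_not.mp hs
    exact ⟨N.isSmoothProjective_fiber_of_mem_smoothBase s (hVU hsV), hg s hsV⟩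
  · -- algebraicity of rational `(2,2)`-classes descends along the birational blow-down
    intro h' c hc hpp
    exact mem_algebraicClasses_of_isBirational N.isSmoothProjective_four_total hX N.blowDown
      (isBirational_blowDown hX N) h' c hc hpp

/-- **`NetReduction` from surface nets on fourfolds with constant geometric genus** (the two
inputs of `netReduction_of` specialised to what the item uses: `r = m = 2`, `(k,p,q) = (2,2,0)`).
If every smooth projective complex fourfold carries a surface net over `ℙ²`, and the smooth fibres
of every such net have one common geometric genus (`SurfaceNet.HasConstantGeometricGenus`, Voisin I
Prop. 9.20), then `NetReduction` holds — by `netReduction_of_generic_geometricGenus` with `V := U`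
the whole smooth base, non-empty by generic smoothness (`FiberNet.smoothBase_nonempty_of_charZero`,
Hartshorne III Cor. 10.7). [cite: Hartshorne1977, II Example 7.17.3 and III Cor. 10.7]
[cite: VoisinHodgeI2002, §9.3.2 Prop. 9.20] -/
theorem netReduction_of_surfaceNets
    (hnet : ∀ ⦃X : SchemeOver ℂ⦄, IsSmoothProjective 4 X → Nonempty (SurfaceNet 2 X))
    (hpg : ∀ ⦃X : SchemeOver ℂ⦄, IsSmoothProjective 4 X → ∀ N : SurfaceNet 2 X,
      N.HasConstantGeometricGenus) :
    Summit.HodgeConjecture.HodgeConjecture.Theses.NoetherLefschetzOneUp.NetReduction :=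
  netReduction_of_generic_geometricGenus hnet fun X hX N => by
    obtain ⟨g, hg⟩ := hpg hX N
    exact ⟨N.smoothBase, FiberNet.smoothBase_nonempty_of_charZero N, le_rfl, g, hg⟩

/-- The printed named facts give the specialised inputs, so `netReduction_of` factors through
`netReduction_of_surfaceNets`: nets of surfaces over `ℙ²` on fourfolds from
`exists_fiberNet_smoothBase_nonempty` at `r = m = 2`, the constant geometric genus from
`fiberNet_exists_hasFibreHodgeNumber` at `(k,p,q) = (2,2,0)`.
[cite: Hartshorne1977, II Example 7.17.3] [cite: VoisinHodgeI2002, §9.3.2 Prop. 9.20] -/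
theorem netReduction_of_eq_of_surfaceNets
    (hnet : Literature.AlgebraicGeometry.Motives.exists_fiberNet_smoothBase_nonempty)
    (hpg : Literature.AlgebraicGeometry.Motives.fiberNet_exists_hasFibreHodgeNumber) :
    Summit.HodgeConjecture.HodgeConjecture.Theses.NoetherLefschetzOneUp.NetReduction :=
  netReduction_of_surfaceNets (fun _ hX => ⟨(hnet 2 2 (by norm_num) hX).choose⟩)
    fun _ _ N => hpg 2 2 N 2 2 0

/-! ## After the discharge of net existence: `NetReduction` ⟸ Voisin I Cor. 9.19 alone

The net-existence fact `exists_fiberNet_smoothBase_nonempty` is now a THEOREM of the tree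
(`exists_fiberNet_smoothBase_nonempty_holds`, `Motives/FiberNetExistenceDischarge` with
`Motives/FiberNetExistenceHolds`: induction on the fibre dimension from de Jong's curve nets by base
change along de Jong's Lemma 4.11/4.12 fibrations of the bases `ℙ^{m+1}`, seat c3 2026-08-16), and the
constancy fact `fiberNet_exists_hasFibreHodgeNumber` is reduced in the tree to the upper semicontinuity of
the Hodge numbers in smooth projective families (`fiberNet_exists_hasFibreHodgeNumber_of_upperSemicontinuous`,
`Motives/FiberNetExistenceProofs`: Ehresmann, `Σ h^{p,q} = b_k`, connectedness of `U(ℂ)` all proved). The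
item therefore hinges on exactly ONE printed theorem, Voisin I Cor. 9.19, as the two theorems below
record (the second takes Cor. 9.19 as the explicit hypothesis `hX`, verbatim as in
`fiberNet_exists_hasFibreHodgeNumber_of_upperSemicontinuous`).
-/

/-- **`NetReduction` from the constancy of the fibre Hodge numbers alone**, net existence being proved
(`exists_fiberNet_smoothBase_nonempty_holds`). CONDITIONAL on the named fact
`fiberNet_exists_hasFibreHodgeNumber` (Voisin I Prop. 9.20) only. [cite: VoisinHodgeI2002, §9.3.2 Prop. 9.20]
[cite: Hartshorne1977, II Example 7.17.3] -/
theorem netReduction_of_hasFibreHodgeNumber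
    (hpg : Literature.AlgebraicGeometry.Motives.fiberNet_exists_hasFibreHodgeNumber) :
    Summit.HodgeConjecture.HodgeConjecture.Theses.NoetherLefschetzOneUp.NetReduction :=
  netReduction_of exists_fiberNet_smoothBase_nonempty_holds hpg

/-- **`NetReduction` from Voisin I Cor. 9.19** (upper semicontinuity of the Hodge numbers of the fibres
of a smooth projective family over a smooth separated base, hypothesis `hX` in the tree's vocabulary):
Cor. 9.19 gives the constancy of the fibre Hodge numbers of every net
(`fiberNet_exists_hasFibreHodgeNumber_of_upperSemicontinuous`, Prop. 9.20), and nets exist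
(`exists_fiberNet_smoothBase_nonempty_holds`). This hypothesis is the exact residue of item
stmt-HodgeConjecture-11604. [cite: VoisinHodgeI2002, §9.3.1 Cor. 9.19 and §9.3.2 Prop. 9.20] -/
theorem netReduction_of_upperSemicontinuous
    (hX : ∀ (n m : ℕ) ⦃𝒳 S : SchemeOver ℂ⦄ (f : 𝒳 ⟶ S) [SmoothOfRelativeDimension m S.hom]
      [IsSeparated S.hom], IsSmoothProjectiveFamily f n →
      ∀ (k p q : ℕ) (s₀ : ComplexPoints S) (A₀ : HodgeModel n (fiberOver f s₀)),
        ∀ᶠ s in nhds s₀, ∀ A : HodgeModel n (fiberOver f s),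
          Module.finrank ℂ ↥(A.hodgePQ k p q) ≤ Module.finrank ℂ ↥(A₀.hodgePQ k p q)) :
    Summit.HodgeConjecture.HodgeConjecture.Theses.NoetherLefschetzOneUp.NetReduction :=
  netReduction_of_hasFibreHodgeNumber (fiberNet_exists_hasFibreHodgeNumber_of_upperSemicontinuous hX)

end Summit.HodgeConjecture.HodgeConjecture.Theorems

end
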